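import Literature.Combinatorics.Sahi2008.UniformSquareAllOrders
import Summits.CriticalPhenomena.PercolationContinuityZ3.Theorems.PercNearOneGluingNoHeavyLowerTailSahiCubeThreeAllOrders

/-!
# `NoHeavyLowerTail` (crux stmt-CriticalPhenomena-4575), Sahi programme P1: Sahi positivity of every order for every FKG
# weight is preserved under ORDINAL SUMS of lattices

Support file (Sahi cell, seat `prim-sahi-p1`, generation 2; `--supports stmt-CriticalPhenomena-4575`).

Call a finite distributive lattice `L` *settled* if every FKG probability weight on `L` is Sahi-positive of every order
(`E_n(f_1,…,f_n) ≥ 0` for all `n` and all nonnegative monotone `f_i` — Sahi's Conjecture 5 / Lieb–Sahi's Conjecture 1.1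
on `L`).  Settled so far (tree): chains, `2^X` for `|X| ≤ 3` and every lattice with `≤ 3` join-irreducibles
(`SahiCubeAllOrders`), every product of two chains and its sublattices (`SahiTwoDim`).  THIS FILE: **if `α` and `β` are
settled then so is the ordinal (vertical) sum `α ⊕ₗ β`** (all of `α` below all of `β`; Mathlib's `Sum.Lex` lattice) —
`sahiPositive_sumLex`.  Examples: `2³` with a new bottom or top (the "claw" lattices with four join-irreducibles), towers
`2³ ⊕ 2³ ⊕ ⋯`, any vertical stacking of settled lattices.  New mathematics, not in print.

Proof.  By the antichain basis (`SahiCubeAllOrders.sahiPositive_of_antichainBasis`) it suffices to treat antichain families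
of `≥ 3` up-sets of `α ⊕ₗ β`.  An up-set either contains the whole upper block `β` ("low type") or avoids the lower block
`α` ("high type"); a high and a low up-set are nested, so an antichain family is all-high or all-low.
* All-high: `U_i = β`-up-sets `V_i`, proper and nonempty; their joint moments under `μ` are those of the `V_i` under the
  weight `ν''(y) = μ(y) + μ(α)·[y = ⊥_β]` on `β` (no proper up-set contains `⊥_β`), and `ν''` is FKG on `β`
  (`isFKGMeasure_pushDownToBot`).  So `E^μ(U) = E^{ν''}(V) ≥ 0` (`sahiE_congr_of_moments`, `β` settled).
* All-low: `U_i = α`-up-sets `W_i` (nonempty) `∪ β`; moments `= μ(β) + μ(∩W)` are those of the `W_i` under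
  `ν'(x) = μ(x) + μ(β)·[x = ⊤_α]` on `α` (every nonempty up-set contains `⊤_α`), again FKG (`isFKGMeasure_pushUpToTop`).
-/

namespace Summit.CriticalPhenomena.PercolationContinuityZ3.Theorems.SahiOrdinalSum

universe u

open Finset Function Literature.Combinatorics.Sahi2008
open scoped BigOperators

noncomputable section

/-! ## Products of indicators and their expectations -/

section Indicators

variable {γ : Type*} [DecidableEq γ]

/-- Pointwise value of a product of indicators. [folklore] -/
theorem prod_setInd_apply {ι : Type*} (S : Finset ι) (U : ι → Finset γ) (z : γ) :
    (∏ i ∈ S, setInd (U i)) z = if ∀ i ∈ S, z ∈ U i then 1 else 0 := by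
  classical
  induction S using Finset.induction_on with
  | empty => simp
  | insert a S ha ih =>
    rw [prod_insert ha, Pi.mul_apply, ih, setInd_apply]
    by_cases h1 : z ∈ U a
    · by_cases h2 : ∀ i ∈ S, z ∈ U i
      · rw [if_pos h1, if_pos h2, if_pos fun i hi => ?_, one_mul]
        rcases mem_insert.1 hi with rfl | hi
        · exact h1
        · exact h2 i hi
      · rw [if_pos h1, if_neg h2, if_neg fun h => h2 fun i hi => h i (mem_insert_of_mem hi), one_mul]
    · rw [if_neg h1, zero_mul, if_neg fun h => h1 (h a (mem_insert_self a S))]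

/-- Expectation of a product of indicators. [folklore] -/
theorem ex_prod_setInd [Fintype γ] {ι : Type*} (w : γ → ℝ) (S : Finset ι) (U : ι → Finset γ) :
    ex w (∏ i ∈ S, setInd (U i)) = ∑ z, if ∀ i ∈ S, z ∈ U i then w z else 0 := by
  rw [ex]
  refine sum_congr rfl fun z _ => ?_
  rw [prod_setInd_apply]
  split_ifs <;> simp

end Indicators

/-! ## Up-sets of an ordinal sum -/

section UpSets

variable {α β : Type*} [Preorder α] [Preorder β]

/-- An up-set of `α ⊕ₗ β` containing a point of the lower block contains the whole upper block. [folklore] -/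
theorem inr_mem_of_inl_mem {U : Set (α ⊕ₗ β)} (hU : IsUpperSet U) {a : α} (ha : (Sum.inlₗ a : α ⊕ₗ β) ∈ U)
    (b : β) : (Sum.inrₗ b : α ⊕ₗ β) ∈ U :=
  hU (Sum.Lex.inl_le_inr a b) ha

end UpSets

/-! ## The two auxiliary weights -/

section Weights

variable {α β : Type*} [DistribLattice α] [Fintype α] [DecidableEq α] [DistribLattice β] [Fintype β] [DecidableEq β]

omit [DistribLattice α] [DecidableEq α] [DistribLattice β] [DecidableEq β] in
/-- Total mass of a weight on `α ⊕ₗ β` splits over the two blocks. [folklore] -/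
theorem sum_sumLex (μ : α ⊕ₗ β → ℝ) :
    ∑ z, μ z = ∑ a, μ (Sum.inlₗ a) + ∑ b, μ (Sum.inrₗ b) :=
  Fintype.sum_sum_type (fun z : α ⊕ β => μ (toLex z))

omit [DecidableEq α] in
/-- **Pushing the lower block down to `⊥_β`.**  For an FKG weight `μ` on `α ⊕ₗ β`, the weight
`ν''(y) = μ(inr y) + μ(α)·[y = ⊥]` on `β` is an FKG probability weight. [this work] -/
theorem isFKGMeasure_pushDownToBot [OrderBot β] {μ : α ⊕ₗ β → ℝ} (hμ : IsFKGMeasure μ) :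
    IsFKGMeasure (fun y : β => μ (Sum.inrₗ y) + if y = ⊥ then ∑ a, μ (Sum.inlₗ a) else 0) := by
  have hm : 0 ≤ ∑ a, μ (Sum.inlₗ a) := sum_nonneg fun a _ => hμ.nonneg _
  refine ⟨fun y => ?_, ?_, fun y z => ?_⟩
  · have := hμ.nonneg (Sum.inrₗ y)
    positivity
  · rw [sum_add_distrib, sum_ite_eq' univ (⊥ : β), if_pos (mem_univ _), add_comm, ← sum_sumLex]
    exact hμ.sum_eq_one
  · have key := hμ.mul_le_mul (Sum.inrₗ y) (Sum.inrₗ z)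
    rw [← Sum.Lex.inr_inf, ← Sum.Lex.inr_sup] at key
    have h0 : ∀ w, 0 ≤ μ w := hμ.nonneg
    by_cases hy : y = ⊥
    · subst hy
      rw [bot_inf_eq, bot_sup_eq]
    · by_cases hz : z = ⊥
      · subst hz
        rw [inf_bot_eq, sup_bot_eq, mul_comm]
      · have hsup : y ⊔ z ≠ ⊥ := fun h => hy (le_bot_iff.1 (h ▸ le_sup_left))
        rw [if_neg hy, if_neg hz, if_neg hsup]
        by_cases hyz : y ⊓ z = ⊥
        · rw [hyz, if_pos rfl]
          rw [hyz] at key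
          nlinarith [h0 (Sum.inrₗ (y ⊔ z)), h0 (Sum.inrₗ ⊥), h0 (Sum.inrₗ y), h0 (Sum.inrₗ z)]
        · rw [if_neg hyz]
          simpa using key

omit [DecidableEq β] in
/-- **Pushing the upper block up to `⊤_α`.**  For an FKG weight `μ` on `α ⊕ₗ β`, the weight
`ν'(x) = μ(inl x) + μ(β)·[x = ⊤]` on `α` is an FKG probability weight. [this work] -/
theorem isFKGMeasure_pushUpToTop [OrderTop α] {μ : α ⊕ₗ β → ℝ} (hμ : IsFKGMeasure μ) :
    IsFKGMeasure (fun x : α => μ (Sum.inlₗ x) + if x = ⊤ then ∑ b, μ (Sum.inrₗ b) else 0) := by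
  have hm : 0 ≤ ∑ b, μ (Sum.inrₗ b) := sum_nonneg fun b _ => hμ.nonneg _
  refine ⟨fun x => ?_, ?_, fun x z => ?_⟩
  · have := hμ.nonneg (Sum.inlₗ x)
    positivity
  · rw [sum_add_distrib, sum_ite_eq' univ (⊤ : α), if_pos (mem_univ _), ← sum_sumLex]
    exact hμ.sum_eq_one
  · have key := hμ.mul_le_mul (Sum.inlₗ x) (Sum.inlₗ z)
    rw [← Sum.Lex.inl_inf, ← Sum.Lex.inl_sup] at key
    have h0 : ∀ w, 0 ≤ μ w := hμ.nonneg
    by_cases hx : x = ⊤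
    · subst hx
      rw [top_inf_eq, top_sup_eq, mul_comm]
    · by_cases hz : z = ⊤
      · subst hz
        rw [inf_top_eq, sup_top_eq]
      · have hinf : x ⊓ z ≠ ⊤ := fun h => hx (top_le_iff.1 (h ▸ inf_le_left))
        rw [if_neg hx, if_neg hz, if_neg hinf]
        by_cases hxz : x ⊔ z = ⊤
        · rw [hxz, if_pos rfl]
          rw [hxz] at key
          nlinarith [h0 (Sum.inlₗ (x ⊓ z)), h0 (Sum.inlₗ ⊤), h0 (Sum.inlₗ x), h0 (Sum.inlₗ z)]
        · rw [if_neg hxz]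
          simpa using key

end Weights

/-! ## The ordinal-sum theorem -/

section Main

variable {α β : Type*} [DistribLattice α] [Fintype α] [DecidableEq α] [DistribLattice β] [Fintype β] [DecidableEq β]

/-- **Sahi positivity of every order for every FKG weight is preserved under ordinal sums.**  If every FKG probability
weight on `α` and every FKG probability weight on `β` is Sahi-positive of every order, then so is every FKG probability
weight on the ordinal sum `α ⊕ₗ β` (all of `α` below all of `β`). [this work] -/
theorem sahiPositive_sumLex (hα : ∀ ν : α → ℝ, IsFKGMeasure ν → ∀ n, SahiPositive ν n)
    (hβ : ∀ ν : β → ℝ, IsFKGMeasure ν → ∀ n, SahiPositive ν n) {μ : α ⊕ₗ β → ℝ} (hμ : IsFKGMeasure μ)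
    (n : ℕ) : SahiPositive μ n := by
  classical
  refine SahiCubeAllOrders.sahiPositive_of_antichainBasis hμ (fun k U hU hanti => ?_) n
  have h01 : (0 : Fin (k + 3)) ≠ 1 := by simp
  have hother : ∀ i : Fin (k + 3), ∃ j : Fin (k + 3), j ≠ i := by
    intro i
    by_cases hi : i = 0
    · exact ⟨1, by rw [hi]; exact h01.symm⟩
    · exact ⟨0, Ne.symm hi⟩
  -- dichotomy: every member contains the whole upper block or avoids the lower block
  have hdich : ∀ i, (∀ b : β, (Sum.inrₗ b : α ⊕ₗ β) ∈ U i) ∨ (∀ a : α, (Sum.inlₗ a : α ⊕ₗ β) ∉ U i) := by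
    intro i
    by_cases h : ∃ a : α, (Sum.inlₗ a : α ⊕ₗ β) ∈ U i
    · obtain ⟨a, ha⟩ := h
      exact Or.inl fun b => inr_mem_of_inl_mem (hU i) ha b
    · push Not at h
      exact Or.inr h
  -- a low member `i` and a high member `j ≠ i` are nested
  have hnest : ∀ i j, i ≠ j → (∀ b : β, (Sum.inrₗ b : α ⊕ₗ β) ∈ U i) →
      (∀ a : α, (Sum.inlₗ a : α ⊕ₗ β) ∉ U j) → False := by
    intro i j hij hi hj
    refine hanti hij fun z hz => ?_
    obtain ⟨z, rfl⟩ := toLex.surjective z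
    rcases z with a | b
    · exact absurd hz (hj a)
    · exact hi b
  by_cases hlow : ∃ i₀, ∀ b : β, (Sum.inrₗ b : α ⊕ₗ β) ∈ U i₀
  · /- ALL LOW -/
    obtain ⟨i₀, hi₀⟩ := hlow
    have hall : ∀ i, ∀ b : β, (Sum.inrₗ b : α ⊕ₗ β) ∈ U i := by
      intro i
      by_cases hi : i = i₀
      · rw [hi]; exact hi₀
      · rcases hdich i with h | h
        · exact h
        · exact (hnest i₀ i (Ne.symm hi) hi₀ h).elim
    obtain ⟨W, hW⟩ : ∃ W : Fin (k + 3) → Finset α, ∀ i, W i = univ.filter fun a => (Sum.inlₗ a : α ⊕ₗ β) ∈ U i :=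
      ⟨_, fun i => rfl⟩
    have hmemW : ∀ i a, a ∈ W i ↔ (Sum.inlₗ a : α ⊕ₗ β) ∈ U i := fun i a => by rw [hW]; simp
    have hWup : ∀ i, IsUpperSet ((W i : Finset α) : Set α) := by
      intro i a a' haa' ha
      rw [Finset.mem_coe, hmemW] at ha ⊢
      exact hU i (Sum.Lex.inl_le_inl_iff.2 haa') ha
    -- each `W i` is nonempty: otherwise `U i` is the upper block, contained in every other member
    have hWne : ∀ i, ∃ a, a ∈ W i := by
      intro i
      by_contra h
      push Not at h
      obtain ⟨j, hj⟩ := hother i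
      refine hanti hj fun z hz => ?_
      obtain ⟨z, rfl⟩ := toLex.surjective z
      rcases z with a | b
      · exact absurd ((hmemW i a).2 hz) (h a)
      · exact hall j b
    obtain ⟨a₀, _⟩ := hWne 0
    haveI : Nonempty α := ⟨a₀⟩
    letI : OrderTop α := Fintype.toOrderTop α
    have hWtop : ∀ i, (⊤ : α) ∈ W i := by
      intro i
      obtain ⟨a, ha⟩ := hWne i
      exact hWup i (le_top (a := a)) ha
    -- the auxiliary weight on `α`: the upper block's mass moved to `⊤_α`
    obtain ⟨ν, hν⟩ : ∃ ν : α → ℝ, ν = fun x => μ (Sum.inlₗ x) + if x = ⊤ then ∑ b, μ (Sum.inrₗ b) else 0 :=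
      ⟨_, rfl⟩
    have hνFKG : IsFKGMeasure ν := by rw [hν]; exact isFKGMeasure_pushUpToTop hμ
    have hmom : ∀ S : Finset (Fin (k + 3)), S.Nonempty →
        ex μ (∏ i ∈ S, setInd (U i)) = ex ν (∏ i ∈ S, setInd (W i)) := by
      intro S hS
      have hA : ∀ a : α, (if ∀ i ∈ S, a ∈ W i then ν a else 0) =
          (if ∀ i ∈ S, (Sum.inlₗ a : α ⊕ₗ β) ∈ U i then μ (Sum.inlₗ a) else 0) +
            if a = ⊤ then ∑ b, μ (Sum.inrₗ b) else 0 := by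
        intro a
        have hiff : (∀ i ∈ S, a ∈ W i) ↔ ∀ i ∈ S, (Sum.inlₗ a : α ⊕ₗ β) ∈ U i :=
          ⟨fun h i hi => (hmemW i a).1 (h i hi), fun h i hi => (hmemW i a).2 (h i hi)⟩
        by_cases h : ∀ i ∈ S, a ∈ W i
        · rw [if_pos h, if_pos (hiff.1 h), hν]
        · have ha : a ≠ ⊤ := fun ha => h fun i _ => ha ▸ hWtop i
          rw [if_neg h, if_neg fun h' => h (hiff.2 h'), if_neg ha, add_zero]
      calc ex μ (∏ i ∈ S, setInd (U i))
          = ∑ z : α ⊕ₗ β, (if ∀ i ∈ S, z ∈ U i then μ z else 0) := by convert ex_prod_setInd μ S U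
        _ = ∑ a : α, (if ∀ i ∈ S, (Sum.inlₗ a : α ⊕ₗ β) ∈ U i then μ (Sum.inlₗ a) else 0) +
              ∑ b : β, (if ∀ i ∈ S, (Sum.inrₗ b : α ⊕ₗ β) ∈ U i then μ (Sum.inrₗ b) else 0) :=
            sum_sumLex _
        _ = ∑ a : α, (if ∀ i ∈ S, (Sum.inlₗ a : α ⊕ₗ β) ∈ U i then μ (Sum.inlₗ a) else 0) +
              ∑ b : β, μ (Sum.inrₗ b) := by
            congr 1
            exact sum_congr rfl fun b _ => if_pos fun i _ => hall i b
        _ = ∑ a : α, ((if ∀ i ∈ S, (Sum.inlₗ a : α ⊕ₗ β) ∈ U i then μ (Sum.inlₗ a) else 0) +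
              if a = ⊤ then ∑ b, μ (Sum.inrₗ b) else 0) := by
            rw [sum_add_distrib, sum_ite_eq' univ (⊤ : α), if_pos (mem_univ _)]
        _ = ∑ a : α, (if ∀ i ∈ S, a ∈ W i then ν a else 0) := (sum_congr rfl fun a _ => (hA a).symm)
        _ = ex ν (∏ i ∈ S, setInd (W i)) := by convert (ex_prod_setInd ν S W).symm
    rw [sahiE_congr_of_moments μ ν (k + 3) (fun i => setInd (U i)) (fun i => setInd (W i)) hmom]
    exact hα ν hνFKG (k + 3) _ (fun i x => setInd_nonneg _ _) (fun i => monotone_setInd (hWup i))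
  · /- ALL HIGH -/
    push Not at hlow
    have hall : ∀ i, ∀ a : α, (Sum.inlₗ a : α ⊕ₗ β) ∉ U i := by
      intro i
      rcases hdich i with h | h
      · obtain ⟨b, hb⟩ := hlow i
        exact absurd (h b) hb
      · exact h
    obtain ⟨V, hV⟩ : ∃ V : Fin (k + 3) → Finset β, ∀ i, V i = univ.filter fun b => (Sum.inrₗ b : α ⊕ₗ β) ∈ U i :=
      ⟨_, fun i => rfl⟩
    have hmemV : ∀ i b, b ∈ V i ↔ (Sum.inrₗ b : α ⊕ₗ β) ∈ U i := fun i b => by rw [hV]; simp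
    have hVup : ∀ i, IsUpperSet ((V i : Finset β) : Set β) := by
      intro i b b' hbb' hb
      rw [Finset.mem_coe, hmemV] at hb ⊢
      exact hU i (Sum.Lex.inr_le_inr_iff.2 hbb') hb
    -- members are nonempty (else nested), hence `β` is nonempty
    have hVne : ∀ i, ∃ b, b ∈ V i := by
      intro i
      by_contra h
      push Not at h
      obtain ⟨j, hj⟩ := hother i
      refine hanti hj fun z hz => ?_
      obtain ⟨z, rfl⟩ := toLex.surjective z
      rcases z with a | b
      · exact absurd hz (hall i a)
      · exact absurd ((hmemV i b).2 hz) (h b)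
    obtain ⟨b₀, _⟩ := hVne 0
    haveI : Nonempty β := ⟨b₀⟩
    letI : OrderBot β := Fintype.toOrderBot β
    -- no member contains `⊥_β`: it would be the whole upper block, containing every other member
    have hVbot : ∀ i, (⊥ : β) ∉ V i := by
      intro i hi
      obtain ⟨j, hj⟩ := hother i
      refine hanti hj.symm fun z hz => ?_
      obtain ⟨z, rfl⟩ := toLex.surjective z
      rcases z with a | b
      · exact absurd hz (hall j a)
      · exact (hmemV i b).1 (hVup i (bot_le (a := b)) hi)
    -- the auxiliary weight on `β`: the lower block's mass moved to `⊥_β`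
    obtain ⟨ν, hν⟩ : ∃ ν : β → ℝ, ν = fun y => μ (Sum.inrₗ y) + if y = ⊥ then ∑ a, μ (Sum.inlₗ a) else 0 :=
      ⟨_, rfl⟩
    have hνFKG : IsFKGMeasure ν := by rw [hν]; exact isFKGMeasure_pushDownToBot hμ
    have hmom : ∀ S : Finset (Fin (k + 3)), S.Nonempty →
        ex μ (∏ i ∈ S, setInd (U i)) = ex ν (∏ i ∈ S, setInd (V i)) := by
      intro S hS
      obtain ⟨i₁, hi₁⟩ := hS
      have hB : ∀ b : β, (if ∀ i ∈ S, b ∈ V i then ν b else 0) =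
          (if ∀ i ∈ S, (Sum.inrₗ b : α ⊕ₗ β) ∈ U i then μ (Sum.inrₗ b) else 0) := by
        intro b
        have hiff : (∀ i ∈ S, b ∈ V i) ↔ ∀ i ∈ S, (Sum.inrₗ b : α ⊕ₗ β) ∈ U i :=
          ⟨fun h i hi => (hmemV i b).1 (h i hi), fun h i hi => (hmemV i b).2 (h i hi)⟩
        by_cases h : ∀ i ∈ S, b ∈ V i
        · have hb : b ≠ ⊥ := fun hb => hVbot i₁ (hb ▸ h i₁ hi₁)
          rw [if_pos h, if_pos (hiff.1 h), hν]
          show μ (Sum.inrₗ b) + (if b = ⊥ then ∑ a, μ (Sum.inlₗ a) else 0) = μ (Sum.inrₗ b)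
          rw [if_neg hb, add_zero]
        · rw [if_neg h, if_neg fun h' => h (hiff.2 h')]
      calc ex μ (∏ i ∈ S, setInd (U i))
          = ∑ z : α ⊕ₗ β, (if ∀ i ∈ S, z ∈ U i then μ z else 0) := by convert ex_prod_setInd μ S U
        _ = ∑ a : α, (if ∀ i ∈ S, (Sum.inlₗ a : α ⊕ₗ β) ∈ U i then μ (Sum.inlₗ a) else 0) +
              ∑ b : β, (if ∀ i ∈ S, (Sum.inrₗ b : α ⊕ₗ β) ∈ U i then μ (Sum.inrₗ b) else 0) :=
            sum_sumLex _
        _ = 0 + ∑ b : β, (if ∀ i ∈ S, (Sum.inrₗ b : α ⊕ₗ β) ∈ U i then μ (Sum.inrₗ b) else 0) := by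
            congr 1
            exact sum_eq_zero fun a _ => if_neg fun h => hall i₁ a (h i₁ hi₁)
        _ = ∑ b : β, (if ∀ i ∈ S, b ∈ V i then ν b else 0) := by
            rw [zero_add]
            exact sum_congr rfl fun b _ => (hB b).symm
        _ = ex ν (∏ i ∈ S, setInd (V i)) := by convert (ex_prod_setInd ν S V).symm
    rw [sahiE_congr_of_moments μ ν (k + 3) (fun i => setInd (U i)) (fun i => setInd (V i)) hmom]
    exact hβ ν hνFKG (k + 3) _ (fun i x => setInd_nonneg _ _) (fun i => monotone_setInd (hVup i))

end Main

/-! ## Corollaries: order isomorphisms, a new bottom or top, towers of cubes -/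

section Corollaries

variable {L M : Type*} [DistribLattice L] [Fintype L] [DecidableEq L] [DistribLattice M] [Fintype M] [DecidableEq M]

omit [DecidableEq L] [DecidableEq M] in
/-- Settledness is invariant under order isomorphisms of lattices: transport the weight along `e`, apply the
hypothesis, and push forward along `e.symm`. [this work] -/
theorem sahiPositive_of_orderIso (e : M ≃o L) (hL : ∀ ν : L → ℝ, IsFKGMeasure ν → ∀ n, SahiPositive ν n)
    {μ : M → ℝ} (hμ : IsFKGMeasure μ) (n : ℕ) : SahiPositive μ n := by
  classical
  have hFKG : IsFKGMeasure (fun x : L => μ (e.symm x)) := by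
    refine ⟨fun x => hμ.nonneg _, ?_, fun x y => ?_⟩
    · rw [← hμ.sum_eq_one]
      exact e.symm.toEquiv.sum_comp μ
    · have h := hμ.mul_le_mul (e.symm x) (e.symm y)
      rwa [← e.symm.map_inf, ← e.symm.map_sup] at h
  have hpush : pushWeight (fun x : L => μ (e.symm x)) e.symm.toEquiv = μ := by
    funext z
    rw [pushWeight_equiv]
    simp
  rw [← hpush]
  exact SahiPositive.of_pushWeight (hL _ hFKG n) (fun x y hxy => e.symm.monotone hxy)

/-- The one-point lattice is settled (a chain). [this work] -/
theorem sahiPositive_punit {μ : PUnit.{u + 1} → ℝ} (hμ : IsFKGMeasure μ) (n : ℕ) : SahiPositive μ n :=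
  sahiPositive_of_linearOrder hμ.nonneg hμ.sum_eq_one n

/-- **Adjoining a new bottom preserves settledness**: if every FKG weight on `L` is Sahi-positive of every order, so is
every FKG weight on `WithBot L` (`≃o PUnit ⊕ₗ L`). [this work] -/
theorem sahiPositive_withBot (hL : ∀ ν : L → ℝ, IsFKGMeasure ν → ∀ n, SahiPositive ν n)
    {μ : WithBot L → ℝ} (hμ : IsFKGMeasure μ) (n : ℕ) : SahiPositive μ n :=
  sahiPositive_of_orderIso WithBot.orderIsoPUnitSumLex
    (fun (_ : PUnit.{1} ⊕ₗ L → ℝ) hν n =>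
      sahiPositive_sumLex (fun (_ : PUnit.{1} → ℝ) h => sahiPositive_punit h) hL hν n) hμ n

/-- **Adjoining a new top preserves settledness**: if every FKG weight on `L` is Sahi-positive of every order, so is
every FKG weight on `WithTop L` (`≃o L ⊕ₗ PUnit`). [this work] -/
theorem sahiPositive_withTop (hL : ∀ ν : L → ℝ, IsFKGMeasure ν → ∀ n, SahiPositive ν n)
    {μ : WithTop L → ℝ} (hμ : IsFKGMeasure μ) (n : ℕ) : SahiPositive μ n :=
  sahiPositive_of_orderIso WithTop.orderIsoSumLexPUnit
    (fun (_ : L ⊕ₗ PUnit.{1} → ℝ) hν n =>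
      sahiPositive_sumLex hL (fun (_ : PUnit.{1} → ℝ) h => sahiPositive_punit h) hν n) hμ n

/-- Example (the "claw" lattices, four join-irreducibles): every FKG weight on `{0,1}³` with a new bottom, or with a new
top, is Sahi-positive of every order (`SahiCubeAllOrders.sahiPositive_cube_three` + the above). [this work] -/
theorem sahiPositive_cube_three_withBot_withTop :
    (∀ (μ : WithBot (Fin 3 → Bool) → ℝ), IsFKGMeasure μ → ∀ n, SahiPositive μ n) ∧
      (∀ (μ : WithTop (Fin 3 → Bool) → ℝ), IsFKGMeasure μ → ∀ n, SahiPositive μ n) :=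
  ⟨fun _ hμ n => sahiPositive_withBot (fun _ h => SahiCubeAllOrders.sahiPositive_cube_three h) hμ n,
    fun _ hμ n => sahiPositive_withTop (fun _ h => SahiCubeAllOrders.sahiPositive_cube_three h) hμ n⟩

/-- Example (a tower of two cubes): every FKG weight on the ordinal sum `{0,1}³ ⊕ₗ {0,1}³` is Sahi-positive of every
order. [this work] -/
theorem sahiPositive_cube_three_tower {μ : (Fin 3 → Bool) ⊕ₗ (Fin 3 → Bool) → ℝ} (hμ : IsFKGMeasure μ) (n : ℕ) :
    SahiPositive μ n :=
  sahiPositive_sumLex (fun _ h => SahiCubeAllOrders.sahiPositive_cube_three h)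
    (fun _ h => SahiCubeAllOrders.sahiPositive_cube_three h) hμ n

end Corollaries

end

end Summit.CriticalPhenomena.PercolationContinuityZ3.Theorems.SahiOrdinalSum
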